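import Summits.ResolutionOfSingularities.ResolutionOfSingularities.Theorems.FrobeniusLadderFRationalResolutionTwoStepChartFactsInterface
import Summits.ResolutionOfSingularities.ResolutionOfSingularities.Theorems.FrobeniusLadderFRationalResolutionQuotientModelResidue
import Summits.ResolutionOfSingularities.ResolutionOfSingularities.Theorems.FrobeniusLadderFRationalResolutionMonomialAlgebraCompletion
import HarnessLib

/-!
# Crux `FrobeniusLadder.FRationalResolution` (stmt-ResolutionOfSingularities-15317), line `redirect`,
# stub `stub_diagonalizableQuotientResolution` — THE MONOID-ALGEBRA MODEL `κ[P] = AddMonoidAlgebra κ P` IS A CHARTED MODEL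
# (a LIGHT presentation in which the chart facts elaborate), and the fixed-point consumer with this model built in

The charted-model consumers keep the model `T` generic because the sub-algebra presentation `κ[χᵈ : d ∈ G] ⊆ κ[x₁,…,xₙ]` of the
monomial algebra makes the chart-ring hypotheses time out at instance synthesis. The MONOID ALGEBRA `AddMonoidAlgebra κ ↥P` of the
weight kernel `P ⊆ ℕⁿ` is a light presentation of the same ring (`…MonomialAlgebraDimension.algEquiv_addMonoidAlgebra`): over it
the chart facts are plain statements. This file discharges every model-side slot of the interface for it, by transport from the
sub-algebra presentation (`…MonomialAlgebraVertex`, `…MonomialAlgebraDimension`):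

* `single_mem_vertexIdeal`, `exists_sub_algebraMap_mem_vertexIdeal`, `mem_vertexIdeal_iff_of_algEquiv` — the vertex ideal
  `𝔳_P = (χᵖ : p ∈ P ∖ 0)` and its transport;
* ★ `vertexIdeal_isMaximal`, ★ `exists_sub_algebraMap_mem_maximalIdeal` (`hres`), ★ `chart` (`χ` with `hχ0`, `hχadd`, `hχm`,
  `hgen`), ★ `ringKrullDim_localization_vertexIdeal_eq_rank` (`hdim`), `finiteType`;
* ★★★ `hasResolution_of_isolated_fixedPoints_of_monoidAlgebra_certificate` — the fixed-point consumer
  (`…TwoStepChartFactsInterface.hasResolution_of_isolated_fixedPoints_of_certificate`, p843406) with the model BUILT IN: at each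
  singular point the data are the fixed-point data of the stub's frame, a finite `G ∌ 0` generating the weight kernel `P`,
  generators and a reduction of `𝔳_P^{b+1}` in `κ(𝔮)[P]`, and the per-chart certificates — nothing else.

Honest label: assembly toward ONE leaf stub (no stub, crux or summit closed). No definitions, no named facts, no sorry.
[cite: Kato1994, Thm. (3.2)] [cite: CoxLittleSchenck2011, §1.1] [cite: Kollar2007, §2.2] [cite: Matsumura1987, Thm. 5.6; §32]
-/

noncomputable section

-- single-problem summit: the doubled namespace component is forced
set_option linter.dupNamespace false

open CategoryTheory AlgebraicGeometry TopologicalSpace IsLocalRing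
open Literature.RingTheory.MvPowerSeries Literature.RingTheory.MvPowerSeries.monoidPowerSeries
open Literature.AlgebraicGeometry.Resolution

namespace Summit.ResolutionOfSingularities.ResolutionOfSingularities.Theorems.FRationalResolution.MonoidAlgebraModel

variable (κ : Type) [Field κ] {n : ℕ} (P : AddSubmonoid (Fin n →₀ ℕ))

/-- The vertex ideal `𝔳_P = (χᵖ : 0 ≠ p ∈ P)` of the monoid algebra `κ[P]`. -/
local notation3 (prettyPrint := false) "𝕍[" κ ", " P "]" =>
  Ideal.span ((fun p : ↥P => AddMonoidAlgebra.single p (1 : κ)) '' {p : ↥P | p ≠ 0})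

/-- The monomial sub-algebra `κ[χᵈ : d ∈ G] ⊆ κ[x₁,…,xₙ]`. -/
local notation3 (prettyPrint := false) "𝕋[" κ ", " G "]" =>
  Algebra.adjoin κ ((fun d : Fin n →₀ ℕ => MvPolynomial.monomial d (1 : κ)) '' G)

/-- Its vertex ideal. -/
local notation3 (prettyPrint := false) "𝕍𝕋[" κ ", " G "]" =>
  Ideal.span {v : ↥𝕋[κ, G] | ∃ d ∈ G, (v : MvPolynomial (Fin n) κ) = MvPolynomial.monomial d 1}

/-! ## §1 The vertex ideal of `κ[P]` -/

/-- `χᵖ ∈ 𝔳_P` for `p ≠ 0`. [folklore] -/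
theorem single_mem_vertexIdeal (p : ↥P) (hp : p ≠ 0) :
    AddMonoidAlgebra.single p (1 : κ) ∈ 𝕍[κ, P] :=
  Ideal.subset_span ⟨p, hp, rfl⟩

/-- Every element of `κ[P]` is a scalar modulo `𝔳_P` (its coefficient at `0`). [folklore] -/
theorem exists_sub_algebraMap_mem_vertexIdeal (f : AddMonoidAlgebra κ ↥P) :
    ∃ c : κ, f - algebraMap κ (AddMonoidAlgebra κ ↥P) c ∈ 𝕍[κ, P] := by
  induction f using AddMonoidAlgebra.induction_linear with
  | zero => exact ⟨0, by rw [map_zero, sub_zero]; exact Ideal.zero_mem _⟩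
  | add f g hf hg =>
    obtain ⟨c, hc⟩ := hf
    obtain ⟨d, hd⟩ := hg
    refine ⟨c + d, ?_⟩
    have : f + g - algebraMap κ (AddMonoidAlgebra κ ↥P) (c + d) =
        (f - algebraMap κ _ c) + (g - algebraMap κ _ d) := by rw [map_add]; abel
    rw [this]
    exact Ideal.add_mem _ hc hd
  | single p c =>
    by_cases hp : p = 0
    · refine ⟨c, ?_⟩
      have : algebraMap κ (AddMonoidAlgebra κ ↥P) c = AddMonoidAlgebra.single 0 c := by
        rw [AddMonoidAlgebra.coe_algebraMap]; rfl
      rw [hp, this, sub_self]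
      exact Ideal.zero_mem _
    · refine ⟨0, ?_⟩
      rw [map_zero, sub_zero]
      have : AddMonoidAlgebra.single p c = c • AddMonoidAlgebra.single p (1 : κ) := by
        rw [AddMonoidAlgebra.smul_single', mul_one]
      rw [this]
      exact Submodule.smul_of_tower_mem _ c (single_mem_vertexIdeal κ P p hp)

/-- **Transport to the sub-algebra presentation**: along `e : κ[P] ≃ₐ κ[χᵈ : d ∈ G]` with `e(χᵖ) = χᵖ` (`⟨G⟩ = P`), an element
of `κ[χᵈ : d ∈ G]` lies in the vertex ideal iff its preimage lies in `𝔳_P`. [folklore; cite: CoxLittleSchenck2011, §1.1] -/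
theorem mem_vertexIdeal_iff_of_algEquiv (G : Set (Fin n →₀ ℕ)) (hG0 : (0 : Fin n →₀ ℕ) ∉ G)
    (hGP : AddSubmonoid.closure G = P) (e : AddMonoidAlgebra κ ↥P ≃ₐ[κ] ↥𝕋[κ, G])
    (he : ∀ p : ↥P, (e (AddMonoidAlgebra.single p 1) : MvPolynomial (Fin n) κ) = MvPolynomial.monomial (p : Fin n →₀ ℕ) 1) :
    ∀ s : ↥𝕋[κ, G], s ∈ 𝕍𝕋[κ, G] ↔ e.symm s ∈ 𝕍[κ, P] := by
  -- (i) the generators of the vertex ideal of the sub-algebra go to `𝔳_P`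
  have h1 : (𝕍𝕋[κ, G]).map e.symm.toRingEquiv.toRingHom ≤ 𝕍[κ, P] := by
    rw [Ideal.map_le_iff_le_comap, Ideal.span_le]
    rintro v ⟨d, hd, hv⟩
    have hdP : d ∈ P := hGP ▸ AddSubmonoid.subset_closure hd
    have hd0 : (⟨d, hdP⟩ : ↥P) ≠ 0 := by
      intro h
      have hd' : d = 0 := congrArg Subtype.val h
      exact hG0 (hd' ▸ hd)
    have hev : e (AddMonoidAlgebra.single ⟨d, hdP⟩ 1) = v := Subtype.ext (by rw [he, hv])
    change e.symm.toRingEquiv.toRingHom v ∈ 𝕍[κ, P]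
    have : e.symm.toRingEquiv.toRingHom v = AddMonoidAlgebra.single ⟨d, hdP⟩ 1 := by
      change e.symm v = _
      rw [← hev, AlgEquiv.symm_apply_apply]
    rw [this]
    exact single_mem_vertexIdeal κ P ⟨d, hdP⟩ hd0
  -- (ii) the generators of `𝔳_P` go to the vertex ideal of the sub-algebra
  have h2 : (𝕍[κ, P]).map e.toRingEquiv.toRingHom ≤ 𝕍𝕋[κ, G] := by
    rw [Ideal.map_le_iff_le_comap, Ideal.span_le]
    rintro _ ⟨p, hp, rfl⟩
    have hpc : (p : Fin n →₀ ℕ) ∈ AddSubmonoid.closure G := hGP ▸ p.2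
    have hp' : (p : Fin n →₀ ℕ) ≠ 0 := fun h => hp (Subtype.ext h)
    have hmem := MonomialAlgebraVertex.monomial_mem_vertexIdeal κ G hpc hp'
    have hep : e (AddMonoidAlgebra.single p 1) =
        ⟨MvPolynomial.monomial (p : Fin n →₀ ℕ) 1, MonomialAlgebraVertex.monomial_mem_of_mem_closure κ G hpc⟩ :=
      Subtype.ext (by rw [he])
    change e.toRingEquiv.toRingHom (AddMonoidAlgebra.single p 1) ∈ 𝕍𝕋[κ, G]
    change e (AddMonoidAlgebra.single p 1) ∈ _
    rw [hep]
    exact hmem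
  intro s
  constructor
  · intro hs
    exact h1 (Ideal.mem_map_of_mem _ hs)
  · intro hs
    have : s = e.toRingEquiv.toRingHom (e.symm s) := by
      change s = e (e.symm s); rw [AlgEquiv.apply_symm_apply]
    rw [this]
    exact h2 (Ideal.mem_map_of_mem _ hs)

/-- ★ **`𝔳_P` is a maximal ideal** (`P = ⟨G⟩`, `G ∌ 0`): transport of `…MonomialAlgebraVertex.vertexIdeal_isMaximal`.
[folklore; cite: CoxLittleSchenck2011, §1.1] -/
theorem vertexIdeal_isMaximal (G : Set (Fin n →₀ ℕ)) (hG0 : (0 : Fin n →₀ ℕ) ∉ G) (hGP : AddSubmonoid.closure G = P) :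
    (𝕍[κ, P]).IsMaximal := by
  obtain ⟨e, he⟩ := MonomialAlgebraDimension.algEquiv_addMonoidAlgebra κ G P hGP
  haveI := MonomialAlgebraVertex.vertexIdeal_isMaximal κ G hG0
  have hiff := mem_vertexIdeal_iff_of_algEquiv κ P G hG0 hGP e he
  have heq : (𝕍𝕋[κ, G]).comap e.toRingEquiv.toRingHom = 𝕍[κ, P] := by
    ext f
    rw [Ideal.mem_comap]
    change e f ∈ 𝕍𝕋[κ, G] ↔ _
    rw [hiff, AlgEquiv.symm_apply_apply]
  rw [← heq]
  exact Ideal.comap_isMaximal_of_surjective _ e.surjective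

/-- ★ **`hres` for the monoid-algebra model**: every element of `κ[P]_{𝔳_P}` is a scalar modulo the maximal ideal. [folklore] -/
theorem exists_sub_algebraMap_mem_maximalIdeal [h𝔳 : (𝕍[κ, P]).IsMaximal] (z : Localization.AtPrime 𝕍[κ, P]) :
    ∃ c : κ, z - algebraMap κ (Localization.AtPrime 𝕍[κ, P]) c ∈ maximalIdeal (Localization.AtPrime 𝕍[κ, P]) :=
  QuotientModelResidue.exists_sub_algebraMap_mem_maximalIdeal_of_forall κ (𝕍[κ, P])
    (exists_sub_algebraMap_mem_vertexIdeal κ P) z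

/-! ## §2 The chart, the dimension, finite type -/

/-- ★ **The monomial chart of `κ[P]`**: `χ(p) = χᵖ` for `p ∈ P` (and `0` off `P`), multiplicative with `χ(0) = 1`, `χ(P ∖ 0) ⊆ 𝔳_P`
generating `𝔳_P`. [folklore; cite: Kato1994, Def. (2.1)] -/
theorem chart : ∃ χ : (Fin n →₀ ℕ) → AddMonoidAlgebra κ ↥P,
    (∀ (p : Fin n →₀ ℕ) (hp : p ∈ P), χ p = AddMonoidAlgebra.single ⟨p, hp⟩ 1) ∧ χ 0 = 1 ∧
    (∀ a ∈ P, ∀ b ∈ P, χ (a + b) = χ a * χ b) ∧ (∀ p ∈ P, p ≠ 0 → χ p ∈ 𝕍[κ, P]) ∧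
    𝕍[κ, P] ≤ Ideal.span (χ '' {p | p ∈ P ∧ p ≠ 0}) := by
  classical
  let χ : (Fin n →₀ ℕ) → AddMonoidAlgebra κ ↥P := fun p =>
    if hp : p ∈ P then AddMonoidAlgebra.single ⟨p, hp⟩ 1 else 0
  have hχ : ∀ (p : Fin n →₀ ℕ) (hp : p ∈ P), χ p = AddMonoidAlgebra.single ⟨p, hp⟩ 1 := fun p hp => dif_pos hp
  refine ⟨χ, hχ, ?_, ?_, ?_, ?_⟩
  · rw [hχ 0 (zero_mem _), AddMonoidAlgebra.one_def]
    rfl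
  · intro a ha b hb
    rw [hχ a ha, hχ b hb, hχ (a + b) (add_mem ha hb), AddMonoidAlgebra.single_mul_single, mul_one]
    rfl
  · intro p hp hp0
    rw [hχ p hp]
    exact single_mem_vertexIdeal κ P ⟨p, hp⟩ fun h => hp0 (congrArg Subtype.val h)
  · apply Ideal.span_le.2
    rintro _ ⟨p, hp, rfl⟩
    refine Ideal.subset_span ⟨(p : Fin n →₀ ℕ), ⟨p.2, fun h => hp (Subtype.ext h)⟩, ?_⟩
    rw [hχ _ p.2]

/-- ★ **`dim κ[P]_{𝔳_P} = rank P`** (`P = ⟨G⟩`, `G` finite, `0 ∉ G`): transport of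
`…MonomialAlgebraDimension.ringKrullDim_localization_vertex_eq_rank` along the localization of `e`. [cite: Matsumura1987, Thm. 5.6]
[cite: Kato1994, Lemma (2.3)] -/
theorem ringKrullDim_localization_vertexIdeal_eq_rank (G : Set (Fin n →₀ ℕ)) (hGfin : G.Finite) (hG0 : (0 : Fin n →₀ ℕ) ∉ G)
    (hGP : AddSubmonoid.closure G = P) [h𝔳 : (𝕍[κ, P]).IsMaximal] :
    ringKrullDim (Localization.AtPrime 𝕍[κ, P]) = rank P := by
  obtain ⟨e, he⟩ := MonomialAlgebraDimension.algEquiv_addMonoidAlgebra κ G P hGP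
  haveI := MonomialAlgebraVertex.vertexIdeal_isMaximal κ G hG0
  have hiff := mem_vertexIdeal_iff_of_algEquiv κ P G hG0 hGP e he
  obtain ⟨f⟩ := CompletedBaseChangeFibrePoints.nonempty_ringEquiv_localization_of_ringEquiv e.symm.toRingEquiv (𝕍𝕋[κ, G])
    (𝕍[κ, P]) hiff
  rw [← ringKrullDim_eq_of_ringEquiv f]
  exact MonomialAlgebraDimension.ringKrullDim_localization_vertex_eq_rank κ G hGfin hG0 P hGP

/-- `κ[P]` is of finite type over `κ` for `P` finitely generated. [folklore] -/
theorem finiteType (hP : P.FG) : Algebra.FiniteType κ (AddMonoidAlgebra κ ↥P) := by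
  haveI : AddMonoid.FG ↥P := (AddMonoid.fg_iff_addSubmonoid_fg P).mpr hP
  infer_instance

/-! ## §3 The fixed-point consumer with the monoid-algebra model built in -/

/-- ★★★ **RESOLUTION OF VARIETIES WHOSE SINGULAR POINTS ARE ISOLATED FIXED POINTS OF QUOTIENT CHARTS CARRYING A MONOID-ALGEBRA
CERTIFICATE.** `X` integral, locally of finite type over a field, finitely many singular points; at each: an étale quotient
chart `Spec S₀ → X` (`S` of finite type over a field, graded by a torsion group) hitting it at a `D(A)`-fixed prime `𝔔` with
homogeneous regular parameters `x, a` (`n = dim S_𝔔`), the weight kernel `P = {m : Σ mᵢ • aᵢ = 0} = ⟨G⟩` (`G` finite, `0 ∉ G`),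
and, in the monoid algebra `κ(𝔮)[P]` with vertex ideal `𝔳`: generators `xv` of `𝔳^{b+1}`, a reduction `y` of it
(`(𝔳^{b+1})^{N+1} ⊆ (y)(𝔳^{b+1})^N`), and on each chart `C = κ(𝔮)[P][𝔳^{b+1}/yⱼ]` a set `G'` with every `C[1/g]` regular, a maximal
`𝔪 ⊇ 𝔪^M ⊇ …` with `𝔪^M ⊆ 𝔳C + (G')` and — if `C_𝔪` is singular — the regularity of `Bl_𝔪(Spec C_𝔪)`. Then `X` has a resolution of
singularities. [cite: Kato1994, Thm. (3.2)] [cite: Kollar2007, §2.2] [cite: GortzWedhorn2020, (13.19) p. 415] [cite: Matsumura1987, §32] -/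
theorem hasResolution_of_isolated_fixedPoints_of_monoidAlgebra_certificate (k : Type) [Field k] (X : Scheme.{0}) [IsIntegral X]
    (f : X ⟶ Spec (.of k)) [LocallyOfFiniteType f] (hfin : (Scheme.regularLocus X)ᶜ.Finite)
    (hchart : ∀ t : X, t ∉ Scheme.regularLocus X →
      ∃ (k' : Type) (_ : Field k') (A : Type) (_ : DecidableEq A) (_ : AddCommGroup A) (_ : AddMonoid.IsTorsion A)
        (S : Type) (_ : CommRing S) (_ : Algebra k' S) (𝒮 : A → Submodule k' S) (_ : GradedAlgebra 𝒮)
        (_ : Algebra.FiniteType k' S) (φ : Spec (.of (𝒮 0)) ⟶ X) (_ : Etale φ)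
        (𝔔 : Ideal S) (_ : 𝔔.IsPrime) (_ : ∀ a : A, a ≠ 0 → ∀ s ∈ 𝒮 a, s ∈ 𝔔)
        (n : ℕ) (x : Fin n → S) (a : Fin n → A) (P : AddSubmonoid (Fin n →₀ ℕ))
        (_ : ∀ i, x i ∈ 𝔔 ∧ x i ∈ 𝒮 (a i))
        (_ : Ideal.span (algebraMap S (Localization.AtPrime 𝔔) '' Set.range x) = maximalIdeal (Localization.AtPrime 𝔔))
        (_ : (n : WithBot ℕ∞) = ringKrullDim (Localization.AtPrime 𝔔))
        (_ : ∀ m, m ∈ P ↔ Finsupp.weight a m = 0)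
        (G : Set (Fin n →₀ ℕ)) (_ : G.Finite) (_ : (0 : Fin n →₀ ℕ) ∉ G) (_ : AddSubmonoid.closure G = P)
        (b nx : ℕ) (xv : Fin nx → AddMonoidAlgebra (ResidueField (Localization.AtPrime (𝔔.comap (algebraMap (𝒮 0) S)))) ↥P)
        (_ : 𝕍[ResidueField (Localization.AtPrime (𝔔.comap (algebraMap (𝒮 0) S))), P] ^ (b + 1) = Ideal.span (Set.range xv))
        (m : ℕ) (y : Fin m → AddMonoidAlgebra (ResidueField (Localization.AtPrime (𝔔.comap (algebraMap (𝒮 0) S)))) ↥P)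
        (_ : ∀ j, y j ∈ 𝕍[ResidueField (Localization.AtPrime (𝔔.comap (algebraMap (𝒮 0) S))), P] ^ (b + 1)) (N : ℕ)
        (_ : (𝕍[ResidueField (Localization.AtPrime (𝔔.comap (algebraMap (𝒮 0) S))), P] ^ (b + 1)) ^ (N + 1) ≤
          Ideal.span (Set.range y) * (𝕍[ResidueField (Localization.AtPrime (𝔔.comap (algebraMap (𝒮 0) S))), P] ^ (b + 1)) ^ N),
        φ ⟨𝔔.comap (algebraMap (𝒮 0) S), inferInstance⟩ = t ∧
        ∀ j : Fin m,
          ∃ (G' : Set (blowupAlgebra (𝕍[ResidueField (Localization.AtPrime (𝔔.comap (algebraMap (𝒮 0) S))), P] ^ (b + 1)) (y j)))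
            (𝔪 : Ideal (blowupAlgebra (𝕍[ResidueField (Localization.AtPrime (𝔔.comap (algebraMap (𝒮 0) S))), P] ^ (b + 1)) (y j)))
            (_ : 𝔪.IsMaximal) (M : ℕ),
            (∀ g ∈ G', IsRegularRing (Localization.Away g)) ∧
            𝔪 ^ M ≤ (𝕍[ResidueField (Localization.AtPrime (𝔔.comap (algebraMap (𝒮 0) S))), P]).map
              (algebraMap _ (blowupAlgebra (𝕍[ResidueField (Localization.AtPrime (𝔔.comap (algebraMap (𝒮 0) S))), P] ^ (b + 1))
                (y j))) ⊔ Ideal.span G' ∧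
            (¬ IsRegularLocalRing (Localization.AtPrime 𝔪) →
              Scheme.IsRegular (affineBlowup (R := Localization.AtPrime 𝔪) (maximalIdeal (Localization.AtPrime 𝔪))))) :
    Scheme.HasResolution X := by
  refine TwoStepChartFactsInterface.hasResolution_of_isolated_fixedPoints_of_certificate k X f hfin fun t ht => ?_
  obtain ⟨k', ik, A, iA₁, iA₂, hA, S, iS₁, iS₂, 𝒮, i𝒮, iS₃, φ, iφ, 𝔔, i𝔔, hfix, n, x, a, P, hxa, hspan, hn, hP, G, hGfin, hG0,
    hGP, b, nx, xv, hxv, m, y, hyJ, N, hred, hφt, hcert⟩ := hchart t ht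
  have hPfg : P.FG := ⟨hGfin.toFinset, by rw [Set.Finite.coe_toFinset, hGP]⟩
  haveI h𝔳 := vertexIdeal_isMaximal (ResidueField (Localization.AtPrime (𝔔.comap (algebraMap (𝒮 0) S)))) P G hG0 hGP
  haveI hT := finiteType (ResidueField (Localization.AtPrime (𝔔.comap (algebraMap (𝒮 0) S)))) P hPfg
  obtain ⟨χ, -, hχ0, hχadd, hχm, hgen⟩ := chart (ResidueField (Localization.AtPrime (𝔔.comap (algebraMap (𝒮 0) S)))) P
  obtain ⟨-, hrank, -, -⟩ := FixedPointCompletionChart.chartData_of_parameters 𝒮 hA 𝔔 hfix x a hxa hspan hn P hP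
    (Localization.AtPrime (𝔔.comap (algebraMap (𝒮 0) S)))
  have hdim : ringKrullDim (Localization.AtPrime 𝕍[(ResidueField (Localization.AtPrime (𝔔.comap (algebraMap (𝒮 0) S)))), P]) = n := by
    rw [ringKrullDim_localization_vertexIdeal_eq_rank (ResidueField (Localization.AtPrime (𝔔.comap (algebraMap (𝒮 0) S)))) P G hGfin hG0 hGP, hrank]
  exact ⟨k', ik, A, iA₁, iA₂, hA, S, iS₁, iS₂, 𝒮, i𝒮, iS₃, φ, iφ, 𝔔, i𝔔, hfix, n, x, a, P, hxa, hspan, hn, hP,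
    AddMonoidAlgebra (ResidueField (Localization.AtPrime (𝔔.comap (algebraMap (𝒮 0) S)))) ↥P, inferInstance, inferInstance, hT, 𝕍[(ResidueField (Localization.AtPrime (𝔔.comap (algebraMap (𝒮 0) S)))), P], h𝔳,
    exists_sub_algebraMap_mem_maximalIdeal (ResidueField (Localization.AtPrime (𝔔.comap (algebraMap (𝒮 0) S)))) P, χ, hχ0, hχadd, hχm, hgen, hdim, b, nx, xv, hxv, m, y, hyJ, N, hred, hφt,
    hcert⟩

end Summit.ResolutionOfSingularities.ResolutionOfSingularities.Theorems.FRationalResolution.MonoidAlgebraModel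

end
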